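import Mathlib.LinearAlgebra.FreeModule.PID
import Mathlib.LinearAlgebra.Dimension.Constructions
import Mathlib.Algebra.Polynomial.Div
import Mathlib.Algebra.Polynomial.FieldDivision
import Mathlib.RingTheory.PrincipalIdealDomain
import Literature.Barriers.MatrixMultiplication.UniversalMethodBarrierDegeneration
import HarnessLib

/-!
# Degenerations cannot increase the slice rank (Alman 2021, Prop. 2.3; Tao–Sawin 2016, Cor. 2)

Topic `Literature/Barriers/MatrixMultiplication`; part of the PROOF of `UniversalMethodBarrier`
(Alman 2021). Main result: `PolyDegeneratesTo.sliceRank_le : t ⊵ s → S(s) ≤ S(t)` over any field —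
property (1) of §1.2 "degenerations cannot increase the (asymptotic) slice rank". PROVED.

## Proof (elementary replacement for "slice rank `≤ r` is Zariski closed")

Take a slice decomposition of `t` with `S(t) = kx + ky + kz` slices and push it through the
`K[λ]`-linear substitution `(A, B, C)`: the degenerate tensor `P = λ^h (s + λ·…)` over `K[λ]`
decomposes with `x`-slice vectors `u_i ∈ K[λ]^{X'}` (`i < kx`), etc. By the Smith normal form of the
submodule they span (`exists_coord_change`, from Mathlib's `Submodule.smithNormalForm` over the PID
`K[λ]`) there are mutually inverse coordinate changes `G, H` and a set `S₁` of `≤ kx` coordinates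
outside which the `G`-coordinates of every `u_i` vanish; similarly `S₂, S₃`. Hence `(G₁ ⊗ G₂ ⊗ G₃) P`
vanishes on the block `S₁ᶜ × S₂ᶜ × S₃ᶜ`; dividing by `λ^h` (no zero divisors) and setting `λ = 0`,
the `K`-tensor `W = (Ḡ₁ ⊗ Ḡ₂ ⊗ Ḡ₃) s` vanishes on that block, so `S(W) ≤ |S₁|+|S₂|+|S₃| ≤ S(t)`
(block criterion), and `s = (H̄₁ ⊗ H̄₂ ⊗ H̄₃) W` is a restriction of `W`.

## Content

* `exists_coord_change` (PID linear algebra), `coeff_zero_sum_mul_eq_ite`, `polySubst_eq_sum`,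
  `IsPolyDegen.exists_eq_X_pow_mul` (`P = λ^h P'`, `P'(0) = s`), `PolyDegeneratesTo.sliceRank_le`.

## References

* J. Alman, Theory of Computing 17 (2021), Prop. 2.3 (p. 13), citing T. Tao, W. Sawin, *Notes on
  the slice rank of tensors* (2016), Cor. 2. [Alman2021]
-/

noncomputable section

open scoped BigOperators Polynomial

namespace Literature.Barriers.MatrixMultiplication

open Literature.Computability.AlgebraicComplexity

universe u

section CoordChange

/-- **Adapted coordinates for a finitely generated submodule of `Rⁿ` over a PID** (Smith normal
form): given `k` vectors `u_i ∈ Rⁿ`, there are a set `S` of at most `k` coordinates and mutually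
inverse changes of coordinates `G`, `H` (`HG = 1`) such that the `G`-coordinates of every `u_i`
vanish outside `S`. [folklore] -/
theorem exists_coord_change {R : Type*} [CommRing R] [IsDomain R] [IsPrincipalIdealRing R]
    {n : Type*} [Fintype n] [DecidableEq n] {k : ℕ} (u : Fin k → n → R) :
    ∃ (S : Finset n) (G H : n → n → R), S.card ≤ k ∧
      (∀ i, ∀ j ∉ S, ∑ a, u i a * G j a = 0) ∧
      (∀ a x, ∑ j, H a j * G j x = if a = x then 1 else 0) := by
  set M : Submodule R (n → R) := Submodule.span R (Set.range u) with hM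
  obtain ⟨m, snf⟩ := Submodule.smithNormalForm (Pi.basisFun R n) M
  refine ⟨Finset.univ.map snf.f, fun j a => snf.bM.repr (Pi.single a 1) j, fun a j => snf.bM j a,
    ?_, ?_, ?_⟩
  · -- `|S| = m = rank M ≤ k`
    rw [Finset.card_map, Finset.card_univ, Fintype.card_fin]
    have h1 : Module.finrank R M = m := by
      rw [Module.finrank_eq_card_basis snf.bN, Fintype.card_fin]
    have h2 : Module.finrank R M ≤ k := by
      have := finrank_range_le_card (R := R) u
      simpa [Set.finrank] using this
    omega
  · -- coordinates outside `S` vanish on `M`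
    intro i j hj
    have hmem : u i ∈ M := Submodule.subset_span ⟨i, rfl⟩
    have hj' : j ∉ Set.range snf.f := by
      rintro ⟨l, rfl⟩
      exact hj (Finset.mem_map.2 ⟨l, Finset.mem_univ _, rfl⟩)
    have hzero := snf.repr_eq_zero_of_notMem_range ⟨u i, hmem⟩ hj'
    -- `repr (u i) j = Σ_a u i a * repr (e_a) j`
    have hexp : snf.bM.repr (u i) j = ∑ a, u i a * snf.bM.repr (Pi.single a 1) j := by
      conv_lhs => rw [pi_eq_sum_univ (u i)]
      simp only [map_sum, map_smul, Finsupp.coe_finsetSum, Finsupp.coe_smul, Finset.sum_apply,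
        Pi.smul_apply, smul_eq_mul]
      refine Finset.sum_congr rfl fun a _ => ?_
      congr 3
      funext x
      simp [Pi.single_apply, eq_comm]
    rw [← hexp]
    exact hzero
  · -- `H G = 1`
    intro a x
    have := congrFun (snf.bM.sum_repr (Pi.single x 1)) a
    rw [Finset.sum_apply] at this
    simp only [Pi.smul_apply, smul_eq_mul] at this
    rw [Pi.single_apply] at this
    rw [← this]
    exact Finset.sum_congr rfl fun j _ => mul_comm _ _

/-- Constant terms of mutually inverse polynomial coordinate changes are mutually inverse.
[folklore] -/
theorem coeff_zero_sum_mul_eq_ite {R : Type*} [CommSemiring R] {n : Type*} [Fintype n]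
    [DecidableEq n] (G H : n → n → R[X])
    (hH : ∀ a x, ∑ j, H a j * G j x = if a = x then 1 else 0) (a x : n) :
    (∑ j, (H a j).coeff 0 * (G j x).coeff 0) = if a = x then (1 : R) else 0 := by
  have := congrArg Polynomial.constantCoeff (hH a x)
  rw [map_sum] at this
  simp only [map_mul, Polynomial.constantCoeff_apply] at this
  rw [this]
  split_ifs <;> simp

end CoordChange

section Main

variable {K : Type u} [Field K]
variable {ι κ μ ι' κ' μ' : Type*} [Fintype ι] [Fintype κ] [Fintype μ]

/-- `polySubst` with the scalar on the right (the shape of `sliceDecomposition_map`). [folklore] -/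
theorem polySubst_eq_sum (t : ι → κ → μ → K) (A : ι → ι' → K[X]) (B : κ → κ' → K[X])
    (C : μ → μ' → K[X]) (a' : ι') (b' : κ') (c' : μ') :
    polySubst t A B C a' b' c' =
      ∑ a, ∑ b, ∑ c, A a a' * B b b' * C c c' * Polynomial.C (t a b c) := by
  simp only [polySubst]
  exact Finset.sum_congr rfl fun a _ => Finset.sum_congr rfl fun b _ =>
    Finset.sum_congr rfl fun c _ => mul_comm _ _

/-- A degeneration of order `h` factors as `λ^h · (s + λ·(…))` entrywise. [cite: Alman2021, §2.4] -/
theorem IsPolyDegen.exists_eq_X_pow_mul {h : ℕ} {t : ι → κ → μ → K} {s : ι' → κ' → μ' → K}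
    {A : ι → ι' → K[X]} {B : κ → κ' → K[X]} {C : μ → μ' → K[X]} (hd : IsPolyDegen h t s A B C) :
    ∃ P' : ι' → κ' → μ' → K[X], ∀ a' b' c', polySubst t A B C a' b' c' = Polynomial.X ^ h * P' a' b' c' ∧
      (P' a' b' c').coeff 0 = s a' b' c' := by
  have hdiv : ∀ a' b' c', Polynomial.X ^ h ∣ polySubst t A B C a' b' c' := by
    intro a' b' c'
    rw [Polynomial.X_pow_dvd_iff]
    intro d hd'
    rw [hd a' b' c' d hd'.le, if_neg hd'.ne]
  choose P' hP' using hdiv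
  refine ⟨P', fun a' b' c' => ⟨hP' a' b' c', ?_⟩⟩
  have := hd a' b' c' h le_rfl
  rw [if_pos rfl, hP' a' b' c', Polynomial.coeff_X_pow_mul'] at this
  simpa using this

/-- **Degenerations cannot increase the slice rank** (Alman 2021, Prop. 2.3, citing Tao–Sawin,
Cor. 2): if `t ⊵ s` then `S(s) ≤ S(t)`. Proof: transport a slice decomposition of `t` to the
degenerate tensor `P = λ^h (s + λ·…)` over `K[λ]`; put the three `K[λ]`-modules spanned by the
slice vectors in Smith normal form (`exists_coord_change`); in the adapted coordinates `P`, hence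
`s + λ·…`, hence (at `λ = 0`) a `K`-coordinate change of `s`, vanishes on a block whose complement
has at most `S(t)` coordinates; conclude with the block criterion and invariance under `GL`.
[cite: Alman2021, Prop. 2.3] -/
theorem PolyDegeneratesTo.sliceRank_le [Fintype ι'] [Fintype κ'] [Fintype μ'] [DecidableEq ι']
    [DecidableEq κ'] [DecidableEq μ'] {t : ι → κ → μ → K} {s : ι' → κ' → μ' → K}
    (hts : PolyDegeneratesTo t s) : sliceRank s ≤ sliceRank t := by
  obtain ⟨kx, ky, kz, hk, α₁, β₁, α₂, β₂, α₃, β₃, ht⟩ := sliceRank_mem t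
  obtain ⟨h, A, B, C, hd⟩ := hts
  -- the slice vectors of the degenerate tensor over `K[X]`
  set u₁ : Fin kx → ι' → K[X] := fun i a' => ∑ a, A a a' * Polynomial.C (α₁ i a) with hu₁
  set u₂ : Fin ky → κ' → K[X] := fun i b' => ∑ b, B b b' * Polynomial.C (α₂ i b) with hu₂
  set u₃ : Fin kz → μ' → K[X] := fun i c' => ∑ c, C c c' * Polynomial.C (α₃ i c) with hu₃
  obtain ⟨S₁, G₁, H₁, hS₁, hG₁, hH₁⟩ := exists_coord_change u₁
  obtain ⟨S₂, G₂, H₂, hS₂, hG₂, hH₂⟩ := exists_coord_change u₂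
  obtain ⟨S₃, G₃, H₃, hS₃, hG₃, hH₃⟩ := exists_coord_change u₃
  obtain ⟨P', hP'⟩ := IsPolyDegen.exists_eq_X_pow_mul hd
  -- the `K`-tensor `W = (Ḡ₁ ⊗ Ḡ₂ ⊗ Ḡ₃) s`
  set W : ι' → κ' → μ' → K := fun j₁ j₂ j₃ => ∑ a', ∑ b', ∑ c',
    (G₁ j₁ a').coeff 0 * (G₂ j₂ b').coeff 0 * (G₃ j₃ c').coeff 0 * s a' b' c' with hW
  -- (1) `W` vanishes on the block `S₁ᶜ × S₂ᶜ × S₃ᶜ`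
  have hblock : ∀ j₁ j₂ j₃, j₁ ∉ S₁ → j₂ ∉ S₂ → j₃ ∉ S₃ → W j₁ j₂ j₃ = 0 := by
    intro j₁ j₂ j₃ hj₁ hj₂ hj₃
    -- `(G ⊗ G ⊗ G) P = 0` at `(j₁, j₂, j₃)`
    have hP0 : (∑ a', ∑ b', ∑ c', G₁ j₁ a' * G₂ j₂ b' * G₃ j₃ c' * polySubst t A B C a' b' c') = 0 := by
      have hdec : ∀ a' b' c', polySubst t A B C a' b' c' =
          (∑ i, u₁ i a' * (∑ b, ∑ c, B b b' * C c c' * Polynomial.C (β₁ i b c))) +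
          (∑ i, u₂ i b' * (∑ a, ∑ c, A a a' * C c c' * Polynomial.C (β₂ i a c))) +
          (∑ i, u₃ i c' * (∑ a, ∑ b, A a a' * B b b' * Polynomial.C (β₃ i a b))) := by
        intro a' b' c'
        rw [polySubst_eq_sum]
        have := sliceDecomposition_map (K := K[X]) (fun i a => Polynomial.C (α₁ i a))
          (fun i b c => Polynomial.C (β₁ i b c)) (fun i b => Polynomial.C (α₂ i b))
          (fun i a c => Polynomial.C (β₂ i a c)) (fun i c => Polynomial.C (α₃ i c))
          (fun i a b => Polynomial.C (β₃ i a b)) (fun a' a => A a a') (fun b' b => B b b')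
          (fun c' c => C c c') a' b' c'
        rw [← this]
        refine Finset.sum_congr rfl fun a _ => Finset.sum_congr rfl fun b _ =>
          Finset.sum_congr rfl fun c _ => ?_
        rw [ht]
        simp only [map_add, map_sum, map_mul]
      simp only [hdec]
      rw [sliceDecomposition_map u₁ _ u₂ _ u₃ _ G₁ G₂ G₃ j₁ j₂ j₃]
      have e1 : ∀ i, (∑ a', G₁ j₁ a' * u₁ i a') = 0 := fun i => by
        rw [← hG₁ i j₁ hj₁]; exact Finset.sum_congr rfl fun a _ => mul_comm _ _
      have e2 : ∀ i, (∑ b', G₂ j₂ b' * u₂ i b') = 0 := fun i => by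
        rw [← hG₂ i j₂ hj₂]; exact Finset.sum_congr rfl fun b _ => mul_comm _ _
      have e3 : ∀ i, (∑ c', G₃ j₃ c' * u₃ i c') = 0 := fun i => by
        rw [← hG₃ i j₃ hj₃]; exact Finset.sum_congr rfl fun c _ => mul_comm _ _
      simp [e1, e2, e3]
    -- divide by `X^h`
    have hQ : Polynomial.X ^ h * (∑ a', ∑ b', ∑ c', G₁ j₁ a' * G₂ j₂ b' * G₃ j₃ c' * P' a' b' c') = 0 := by
      rw [← hP0, Finset.mul_sum]
      refine Finset.sum_congr rfl fun a' _ => ?_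
      rw [Finset.mul_sum]
      refine Finset.sum_congr rfl fun b' _ => ?_
      rw [Finset.mul_sum]
      refine Finset.sum_congr rfl fun c' _ => ?_
      rw [(hP' a' b' c').1]
      ring
    have hQ' : (∑ a', ∑ b', ∑ c', G₁ j₁ a' * G₂ j₂ b' * G₃ j₃ c' * P' a' b' c') = 0 :=
      (mul_eq_zero.1 hQ).resolve_left (pow_ne_zero h Polynomial.X_ne_zero)
    -- constant coefficients
    have := congrArg (Polynomial.coeff · 0) hQ'
    simp only [Polynomial.finsetSum_coeff, Polynomial.coeff_zero] at this
    rw [hW]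
    dsimp only
    rw [← this]
    refine Finset.sum_congr rfl fun a' _ => Finset.sum_congr rfl fun b' _ =>
      Finset.sum_congr rfl fun c' _ => ?_
    rw [← (hP' a' b' c').2, ← Polynomial.constantCoeff_apply, ← Polynomial.constantCoeff_apply,
      ← Polynomial.constantCoeff_apply, ← Polynomial.constantCoeff_apply,
      ← Polynomial.constantCoeff_apply, map_mul, map_mul, map_mul]
  -- (2) `s` is a restriction of `W` (invert the coordinate changes at `λ = 0`)
  have hres : TensorRestrictsTo W s := by
    refine ⟨fun a j => (H₁ a j).coeff 0, fun b j => (H₂ b j).coeff 0, fun c j => (H₃ c j).coeff 0,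
      fun a₀ b₀ c₀ => ?_⟩
    -- expand and regroup the six-fold sum
    have step : (∑ j₁, ∑ j₂, ∑ j₃, (H₁ a₀ j₁).coeff 0 * (H₂ b₀ j₂).coeff 0 * (H₃ c₀ j₃).coeff 0 *
        W j₁ j₂ j₃) = ∑ a', ∑ b', ∑ c', s a' b' c' *
          ((∑ j₁, (H₁ a₀ j₁).coeff 0 * (G₁ j₁ a').coeff 0) *
           (∑ j₂, (H₂ b₀ j₂).coeff 0 * (G₂ j₂ b').coeff 0) *
           (∑ j₃, (H₃ c₀ j₃).coeff 0 * (G₃ j₃ c').coeff 0)) := by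
      conv_rhs => simp only [mul_sum_mul_sum_mul_sum]
      conv_lhs => simp only [hW, Finset.mul_sum]
      rw [sum_comm₃]
      refine Finset.sum_congr rfl fun a' _ => Finset.sum_congr rfl fun b' _ =>
        Finset.sum_congr rfl fun c' _ => Finset.sum_congr rfl fun j₁ _ =>
        Finset.sum_congr rfl fun j₂ _ => Finset.sum_congr rfl fun j₃ _ => ?_
      ring
    rw [step]
    simp only [coeff_zero_sum_mul_eq_ite G₁ H₁ hH₁, coeff_zero_sum_mul_eq_ite G₂ H₂ hH₂,
      coeff_zero_sum_mul_eq_ite G₃ H₃ hH₃]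
    rw [Finset.sum_eq_single a₀]
    · rw [Finset.sum_eq_single b₀]
      · rw [Finset.sum_eq_single c₀]
        · simp
        · intro c _ hc; simp [Ne.symm hc]
        · simp
      · intro b _ hb; exact Finset.sum_eq_zero fun c _ => by simp [Ne.symm hb]
      · simp
    · intro a _ ha
      exact Finset.sum_eq_zero fun b _ => Finset.sum_eq_zero fun c _ => by simp [Ne.symm ha]
    · simp
  -- (3) conclude
  calc sliceRank s ≤ sliceRank W := sliceRank_le_of_tensorRestrictsTo hres
    _ ≤ S₁.card + S₂.card + S₃.card := sliceRank_le_of_block W S₁ S₂ S₃ hblock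
    _ ≤ kx + ky + kz := by omega
    _ = sliceRank t := hk

end Main


end Literature.Barriers.MatrixMultiplication

end
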